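import Summits.HodgeConjecture.HodgeConjecture.Theorems.VHCAbelianSchemesRoadIsogenyTwistIotaCompat
import Literature.AlgebraicGeometry.HodgeTheory.TwistJetPushforwardIso
import HarnessLib

/-!
# Road №4 (`VHCAbelianSchemesRoad`) — (W) for the twist datum α₀: `α_{j+1}(d(g♯a) ∧ φ) = da ∧ α_j(φ)`
# (the `wedgeD`-compatibility of `isogenyTwistHodgePushforwardIso`, input (W) of the cell's `TwistPushforwardCompat` for `stub_atiyahPair`,
# crux stmt-HodgeConjecture-26512)

research route conditional on HC_CM; not a corollary; Q11.4-sentence-2 already refuted in dim ≥ 3.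

Seat core-w6 (width copy of core-D), fourth sequel of `…IsogenyTwistPushforwardIso.lean` ((L7b) `α₀ = isogenyTwistPushforwardIsoFamily hΩ`,
p650171), `…IsogenyPullbackFormsIso.lean` ((P2′), p652022) and `…IsogenyTwistIotaCompat.lean` ((b) `g_*(ι_E) ≫ α_0 = ι_{g_*E}` and the
frame components of α, p653206). `--supports stmt-HodgeConjecture-26512 --as helper`; closes NO stub; CONDITIONAL on the named fact
«`Ω¹_A` free» (`hΩ : Mumford1970_cotangentSheaf_abelianVariety_free`) only; nothing here says (AtPair), (TrPair), (c1), T′, `HC_AV`, `HC_CM`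
or HC holds; HC_CM HELD, by name only; typed ≠ proved.

WHAT IS PROVED.
* §5 `pi_sections_ext` (sections of `∏ᶜ M_i` are determined by their components), `app_sum`, and the frame calculus of an iso
  `e : M ≅ ∏ᶜ_{Fin N} 𝒪`: `frameVec_comp_coord` (`vec_I ≫ coord_K = δ_{IK}`), `sum_coord_comp_frameVec` (`Σ_I coord_I ≫ vec_I = 𝟙`),
  `sum_coord_comp_frameVec_conj` (the same for the frame moved by an automorphism `θ`).
* §6 `formsTwist_app_comap_frameVec` ∕ `formsTwist_inv_app_frameVec`: **`θ_q(g)⁻¹ ω_I = g^♯ ω_I`** — the `dg`-twist moves the global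
  frame of `Ω^q_A` to the pulled-back frame (from p653206's `comap_comp_map_formsTwist_frameCoord`: `coord_K(θ(g^♯ω_I)) = g♯δ_{KI} = δ_{KI}`).
* §7 linear algebra over `𝒪|_V`: `over_unit_endo_eq_overScalar` (endomorphisms of `𝒪|_V` are scalars), `overFunctor_map_sum`,
  **`hom_eq_sum_evalAt_comp`** (`φ : E^∨|_V → M|_V` decomposes along a frame of `M` as `Σ_I ev_{t_I} ≫ vec_I`, `t_I = (E ≅ E^∨∨)⁻¹(φ ≫ coord_I)`),
  `inv_toBidual_app_sum_evalAt_comp_overScalar` ∕ `_endo` (`(E ≅ E^∨∨)⁻¹(Σ_I ev_{x_I} ≫ m_I) = Σ_I m_I(1)·x_I`).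
* §8 `wedgeFrameCoeff_comap`: the wedge coefficients along the pulled-back frame are the `g♯` of the wedge coefficients
  (`wedge_evalAt_dSection_comap` + §6 + `comap_comp_map_formsTwist_frameCoord`), and the target
  **`isogenyTwistHodgePushforwardIso_hom_app_wedgeD` :
  `(α_{j+1}).hom.app U (wedgeD E j (g⁻¹U) (g♯a) φ) = wedgeD (g_*E) j U a ((α_j).hom.app U φ)`** — literally the field `hom_app_wedgeD` of
  `TwistPushforwardCompat g.hom.hom.hom IsFiniteLocallyFree` for `hom hE j := (isogenyTwistHodgePushforwardIso hΩ A g hg j E hE).hom`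
  (the field `naturality` is p650171's `isogenyTwistHodgePushforwardIso_naturality`). Proof: test after the injective
  `(𝓗om((g_*E)^∨, Ωʲ⁺¹) ≅ ∏ g_*E) ≫ π_K` on sections over `U`; decompose `φ` along the `θ⁻¹`-moved frame and `α_j φ` along the frame —
  the components `t_I ∈ Γ(g⁻¹U, E)` agree by p653206 §3 — and both sides become `Σ_I c_{KI} · t_I`.

References: [cite: Hartshorne1977, II Ex. 5.1 (a), (b), II Ex. 5.16 (e), II Prop. 8.11, III Prop. 10.4] [cite: MumfordAV1970, §4 (iii) (p. 42)]
[cite: BuchweitzFlenner2003, §3 (twisted jet sequences; functoriality in the scheme)] [cite: StacksProject, Tag 01DU].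
-/

noncomputable section

-- `TopCat.Presheaf`/`Scheme.Modules` are not reducible (as in Mathlib's `AlgebraicGeometry/Modules/Sheaf.lean`).
set_option backward.isDefEq.respectTransparency false
set_option linter.dupNamespace false -- the cell's namespace repeats the summit name, as in every `Ring2*` file

namespace Summit.HodgeConjecture.HodgeConjecture.Ring2.SemiregularRepresentatives

open CategoryTheory CategoryTheory.Limits AlgebraicGeometry Opposite TopologicalSpace
open AlgebraicGeometry.Scheme.Modules
open Literature.AlgebraicGeometry Literature.AlgebraicGeometry.Modules Literature.AlgebraicGeometry.Motives
open Literature.AlgebraicGeometry.Motives.AbelianVariety Literature.AlgebraicGeometry.HodgeTheory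
open Literature.AlgebraicGeometry.KTheory Literature.AlgebraicGeometry.Morphisms

/-! ## §5 Sections of a finite product; sums of morphisms on sections; frames `M ≅ ∏ᶜ 𝒪` -/

section PiSections

variable {X : Scheme.{0}}

/-- **Sections of `∏ᶜ M_i` are determined by their components** (sections are morphisms from the free module on the representable
`h_U`, the tree's `freeYonedaModuleHomEquiv`, and `Pi.hom_ext`). [cite: StacksProject, Tag 01DU] -/
theorem pi_sections_ext {N : ℕ} (M : Fin N → X.Modules) (U : X.Opens) (x y : Γ(∏ᶜ M, U))
    (h : ∀ K, (Limits.Pi.π M K).app U x = (Limits.Pi.π M K).app U y) : x = y := by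
  obtain ⟨φ, rfl⟩ := (freeYonedaModuleHomEquiv X.ringCatSheaf (U := U) (M := ∏ᶜ M)).surjective x
  obtain ⟨ψ, rfl⟩ := (freeYonedaModuleHomEquiv X.ringCatSheaf (U := U) (M := ∏ᶜ M)).surjective y
  congr 1
  refine Limits.Pi.hom_ext _ _ fun K => (freeYonedaModuleHomEquiv X.ringCatSheaf).injective ?_
  rw [freeYonedaModuleHomEquiv_comp, freeYonedaModuleHomEquiv_comp]
  exact h K

/-- Sections of a finite sum of morphisms. [folklore] -/
theorem app_sum {M N : X.Modules} {ι : Type*} (t : Finset ι) (f : ι → (M ⟶ N)) (U : X.Opens) (x : Γ(M, U)) :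
    (t.sum f).app U x = t.sum fun i => (f i).app U x := by
  classical
  induction t using Finset.induction_on with
  | empty => simp only [Finset.sum_empty, Scheme.Modules.Hom.zero_app]; rfl
  | insert i t hi ih => rw [Finset.sum_insert hi, Finset.sum_insert hi, Scheme.Modules.Hom.add_app, ← ih]; rfl

/-- **Reconstruction**: `Σ_I π_I ≫ vec_I = 𝟙` on `∏ᶜ_{Fin N} 𝒪`, `vec_I = (δ_{IK})_K`. [folklore] -/
theorem sum_π_comp_piLift_ite (N : ℕ) :
    (Finset.univ.sum fun I : Fin N => Limits.Pi.π _ I ≫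
      Limits.Pi.lift (fun K : Fin N => if I = K then 𝟙 (unitModule X) else 0)) = 𝟙 (∏ᶜ fun _ : Fin N => unitModule X) := by
  classical
  refine Limits.Pi.hom_ext _ _ fun K => ?_
  rw [Preadditive.sum_comp, Category.id_comp]
  simp only [Category.assoc, Limits.Pi.lift_π]
  rw [Finset.sum_eq_single K]
  · rw [if_pos rfl, Category.comp_id]
  · intro b _ hb; rw [if_neg hb, comp_zero]
  · intro h; exact absurd (Finset.mem_univ K) h

variable {M : X.Modules} {N : ℕ} (e : M ≅ ∏ᶜ fun _ : Fin N => unitModule X)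

/-- For a frame `e : M ≅ ∏ᶜ 𝒪`: `vec_I ≫ coord_K = δ_{IK}` (`coord_K = e ≫ π_K`, `vec_I = (δ_{IK})_K ≫ e⁻¹`). [folklore] -/
theorem frameVec_comp_coord (I K : Fin N) :
    (Limits.Pi.lift (fun K : Fin N => if I = K then 𝟙 (unitModule X) else 0) ≫ e.inv) ≫ e.hom ≫ Limits.Pi.π _ K =
      if I = K then 𝟙 _ else 0 := by
  rw [Category.assoc, Iso.inv_hom_id_assoc, Limits.Pi.lift_π]

/-- **Frame reconstruction** for `e : M ≅ ∏ᶜ 𝒪`: `Σ_I coord_I ≫ vec_I = 𝟙_M`. [folklore] -/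
theorem sum_coord_comp_frameVec :
    (Finset.univ.sum fun I : Fin N => (e.hom ≫ Limits.Pi.π _ I) ≫
      (Limits.Pi.lift (fun K : Fin N => if I = K then 𝟙 (unitModule X) else 0) ≫ e.inv)) = 𝟙 M := by
  have h := sum_π_comp_piLift_ite (X := X) N
  have h' := congrArg (fun φ => e.hom ≫ φ ≫ e.inv) h
  simp only [Category.id_comp, Iso.hom_inv_id, Preadditive.sum_comp, Preadditive.comp_sum, Category.assoc] at h'
  simpa only [Category.assoc] using h'

/-- The same for the frame moved by an automorphism `θ` of `M`: `Σ_I (θ ≫ coord_I) ≫ (vec_I ≫ θ⁻¹) = 𝟙_M`. [folklore] -/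
theorem sum_coord_comp_frameVec_conj (θ : M ≅ M) :
    (Finset.univ.sum fun I : Fin N => (θ.hom ≫ e.hom ≫ Limits.Pi.π _ I) ≫
      (Limits.Pi.lift (fun K : Fin N => if I = K then 𝟙 (unitModule X) else 0) ≫ e.inv ≫ θ.inv)) = 𝟙 M := by
  have h := congrArg (fun φ => θ.hom ≫ φ ≫ θ.inv) (sum_coord_comp_frameVec e)
  simp only [Category.id_comp, Iso.hom_inv_id, Preadditive.sum_comp, Preadditive.comp_sum, Category.assoc] at h
  simpa only [Category.assoc] using h

end PiSections

/-! ## §6 The pulled-back frame of `Ω^q_A` is the `θ⁻¹`-moved frame -/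

section FrameCalc

/-- **The `dg`-twist undoes `g^♯` on the frame**: `θ_q(g)(g^♯(ω_I|_U)) = ω_I|_{g⁻¹U}` for the global frame vectors `ω_I = vec_I(1)`
(`vec_I = (δ_{IK})_K ≫ frame⁻¹`; coordinates: `coord_K(θ(g^♯ω_I)) = g♯(coord_K ω_I) = δ_{KI}`). CONDITIONAL on `hΩ`.
[cite: Hartshorne1977, III Prop. 10.4] [cite: MumfordAV1970, §4 (iii) (p. 42)] -/
theorem formsTwist_app_comap_frameVec (hΩ : Mumford1970_cotangentSheaf_abelianVariety_free) (A : AbelianVariety ℂ)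
    (q : ℕ) (g : A ⟶ A) (hg : IsIsogeny g) (I : Fin (A.dim.choose q)) (U : A.X.left.Opens) :
    (isogenyFormsTwist hΩ A g q).hom.app (Hom.toSchemeHom g ⁻¹ᵁ U) ((hodgeSheaf.comap g.hom.hom.hom q).app U
        ((Limits.Pi.lift (fun K : Fin (A.dim.choose q) => if I = K then 𝟙 (unitModule A.X.left) else 0) ≫
          (hodgeSheafFrame hΩ A q).inv).app U (1 : Γ(A.X.left, U)))) =
      (Limits.Pi.lift (fun K : Fin (A.dim.choose q) => if I = K then 𝟙 (unitModule A.X.left) else 0) ≫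
          (hodgeSheafFrame hΩ A q).inv).app (Hom.toSchemeHom g ⁻¹ᵁ U) (1 : Γ(A.X.left, Hom.toSchemeHom g ⁻¹ᵁ U)) := by
  -- compare frame coordinates
  apply ((ConcreteCategory.bijective_of_isIso ((hodgeSheafFrame hΩ A q).hom.app (Hom.toSchemeHom g ⁻¹ᵁ U))).1)
  refine pi_sections_ext _ _ _ _ fun K => ?_
  have h := congrArg (fun φ : unitModule A.X.left ⟶ (pushforward (Hom.toSchemeHom g)).obj (unitModule A.X.left) =>
      Scheme.Modules.Hom.app φ U (1 : Γ(A.X.left, U)))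
    (show (Limits.Pi.lift (fun K : Fin (A.dim.choose q) => if I = K then 𝟙 (unitModule A.X.left) else 0) ≫
          (hodgeSheafFrame hΩ A q).inv) ≫ hodgeSheaf.comap g.hom.hom.hom q ≫ (pushforward (Hom.toSchemeHom g)).map
        ((isogenyFormsTwist hΩ A g q).hom ≫ (hodgeSheafFrame hΩ A q).hom ≫ Limits.Pi.π _ K) =
        (if I = K then 𝟙 _ else 0) ≫ unitPushforwardHom (Hom.toSchemeHom g) by
      rw [comap_comp_map_formsTwist_frameCoord hΩ A g q hg K, ← Category.assoc, frameVec_comp_coord])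
  have hδ := congrArg (fun φ : unitModule A.X.left ⟶ unitModule A.X.left =>
    Scheme.Modules.Hom.app φ (Hom.toSchemeHom g ⁻¹ᵁ U) (1 : Γ(A.X.left, Hom.toSchemeHom g ⁻¹ᵁ U)))
    (frameVec_comp_coord (hodgeSheafFrame hΩ A q) I K)
  simp only [Scheme.Modules.Hom.comp_app, CategoryTheory.comp_apply, pushforward_map_app] at h hδ
  change (Limits.Pi.π (fun _ : Fin (A.dim.choose q) => unitModule A.X.left) K).app _ ((hodgeSheafFrame hΩ A q).hom.app _ _) =
    (Limits.Pi.π (fun _ : Fin (A.dim.choose q) => unitModule A.X.left) K).app _ ((hodgeSheafFrame hΩ A q).hom.app _ _)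
  refine h.trans (Eq.trans ?_ hδ.symm)
  split_ifs with hIK
  · rw [unitPushforwardHom_app_apply]
    change (Hom.toSchemeHom g).app U (1 : Γ(A.X.left, U)) = (1 : Γ(A.X.left, Hom.toSchemeHom g ⁻¹ᵁ U))
    exact map_one _
  · rw [unitPushforwardHom_app_apply]
    change (Hom.toSchemeHom g).app U (0 : Γ(A.X.left, U)) = (0 : Γ(A.X.left, Hom.toSchemeHom g ⁻¹ᵁ U))
    exact map_zero _

/-- The same in the form `θ_q(g)⁻¹(ω_I|_{g⁻¹U}) = g^♯(ω_I|_U)`: **the `θ⁻¹`-moved frame is the pulled-back frame**. CONDITIONAL on `hΩ`.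
[cite: Hartshorne1977, III Prop. 10.4] [cite: MumfordAV1970, §4 (iii) (p. 42)] -/
theorem formsTwist_inv_app_frameVec (hΩ : Mumford1970_cotangentSheaf_abelianVariety_free) (A : AbelianVariety ℂ)
    (q : ℕ) (g : A ⟶ A) (hg : IsIsogeny g) (I : Fin (A.dim.choose q)) (U : A.X.left.Opens) :
    (isogenyFormsTwist hΩ A g q).inv.app (Hom.toSchemeHom g ⁻¹ᵁ U)
        ((Limits.Pi.lift (fun K : Fin (A.dim.choose q) => if I = K then 𝟙 (unitModule A.X.left) else 0) ≫
          (hodgeSheafFrame hΩ A q).inv).app (Hom.toSchemeHom g ⁻¹ᵁ U) (1 : Γ(A.X.left, Hom.toSchemeHom g ⁻¹ᵁ U))) =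
      (hodgeSheaf.comap g.hom.hom.hom q).app U
        ((Limits.Pi.lift (fun K : Fin (A.dim.choose q) => if I = K then 𝟙 (unitModule A.X.left) else 0) ≫
          (hodgeSheafFrame hΩ A q).inv).app U (1 : Γ(A.X.left, U))) := by
  rw [← formsTwist_app_comap_frameVec hΩ A q g hg I U, ← CategoryTheory.comp_apply, ← Scheme.Modules.Hom.comp_app,
    Iso.hom_inv_id, Scheme.Modules.Hom.id_app]
  rfl

end FrameCalc

/-! ## §7 Linear algebra over `𝒪|_V`: decomposition of `φ : E^∨|_V → M|_V` along a frame of `M`; endomorphisms of `𝒪|_V` -/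

section OverCalc

variable {X : Scheme.{0}}

/-- **Endomorphisms of `𝒪_X|_V` are scalars**: `m = (m(1)) · 𝟙`. [folklore] -/
theorem over_unit_endo_eq_overScalar (V : X.Opens) (m : (unitModule X).over V ⟶ (unitModule X).over V) :
    m = overScalar (unitModule X) V (appLE m (𝟙 V) (1 : Γ(X, V))) := by
  refine hom_ext_of_appLE fun W k (s : Γ(X, W)) => ?_
  have h1 : (s : Γ(unitModule X, W)) = s • (X.presheaf.map k.op (1 : Γ(X, V)) : Γ(unitModule X, W)) := by
    change s = s * X.presheaf.map k.op 1
    rw [map_one, mul_one]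
  have hk : appLE m k (X.presheaf.map k.op (1 : Γ(X, V)) : Γ(unitModule X, W)) =
      X.presheaf.map k.op (appLE m (𝟙 V) (1 : Γ(X, V))) := by
    have h := appLE_map m (𝟙 V) k (1 : Γ(X, V))
    rw [Category.comp_id] at h
    exact h
  rw [appLE_overScalar]
  conv_lhs => rw [h1, appLE_smul_right, hk]
  change s * _ = _ * s
  exact mul_comm _ _

/-- Values of a finite sum of morphisms of restricted modules. [folklore] -/
theorem appLE_finset_sum {E M : X.Modules} {U W : X.Opens} {ι : Type*} (t : Finset ι)
    (f : ι → (E.over U ⟶ M.over U)) (k : W ⟶ U) (s : Γ(E, W)) :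
    appLE (t.sum f) k s = t.sum fun i => appLE (f i) k s := by
  classical
  induction t using Finset.induction_on with
  | empty => simp only [Finset.sum_empty, appLE_zero]
  | insert i t hi ih => rw [Finset.sum_insert hi, Finset.sum_insert hi, appLE_add, ih]

/-- Restriction to an open is additive on finite sums of morphisms. [folklore] -/
theorem overFunctor_map_sum {E M : X.Modules} (V : X.Opens) {ι : Type*} (t : Finset ι) (f : ι → (E ⟶ M)) :
    (SheafOfModules.overFunctor _ V).map (t.sum f) = t.sum fun i => (SheafOfModules.overFunctor _ V).map (f i) := by
  refine hom_ext_of_appLE fun W k s => ?_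
  rw [appLE_over_map, app_sum, appLE_finset_sum]
  exact Finset.sum_congr rfl fun i _ => (appLE_over_map (f i) k s).symm

/-- **Decomposition of `φ : E^∨|_V ⟶ M|_V` along a frame** `(c_I : M → 𝒪, v_I : 𝒪 → M)` with `Σ_I c_I ≫ v_I = 𝟙`, for `E`
with `E ≅ E^∨∨`: `φ = Σ_I ev_{t_I} ≫ v_I|_V` with `t_I := (E ≅ E^∨∨)⁻¹(φ ≫ c_I|_V) ∈ Γ(E, V)`. [cite: Hartshorne1977, II Ex. 5.1 (a), (b)] -/
theorem hom_eq_sum_evalAt_comp (F M : X.Modules) [IsIso (toBidual F (unitModule X))] {N : ℕ}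
    (c : Fin N → (M ⟶ unitModule X)) (v : Fin N → (unitModule X ⟶ M))
    (hcv : (Finset.univ.sum fun I => c I ≫ v I) = 𝟙 M) (V : X.Opens) (φ : (dual F).over V ⟶ M.over V) :
    φ = Finset.univ.sum fun I => evalAt (M := unitModule X)
      ((inv (toBidual F (unitModule X))).app V (φ ≫ (SheafOfModules.overFunctor _ V).map (c I))) ≫
        (SheafOfModules.overFunctor _ V).map (v I) := by
  have h0 : φ = φ ≫ (SheafOfModules.overFunctor _ V).map (𝟙 M) := by
    rw [CategoryTheory.Functor.map_id]; exact (Category.comp_id φ).symm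
  conv_lhs => rw [h0, ← hcv, overFunctor_map_sum, Preadditive.comp_sum]
  refine Finset.sum_congr rfl fun I _ => ?_
  rw [Functor.map_comp, ← Category.assoc]
  congr 1
  rw [← toBidual_app_apply, ← CategoryTheory.comp_apply, ← Scheme.Modules.Hom.comp_app, IsIso.inv_hom_id,
    Scheme.Modules.Hom.id_app]
  rfl

/-- `(E ≅ E^∨∨)⁻¹ (Σ_I ev_{x_I} ≫ (c_I · 𝟙)) = Σ_I c_I · x_I`. [cite: Hartshorne1977, II Ex. 5.1 (a)] -/
theorem inv_toBidual_app_sum_evalAt_comp_overScalar (F : X.Modules) [IsIso (toBidual F (unitModule X))] (V : X.Opens)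
    {N : ℕ} (x : Fin N → Γ(F, V)) (c : Fin N → Γ(X, V)) :
    (inv (toBidual F (unitModule X))).app V (Finset.univ.sum fun I =>
        evalAt (M := unitModule X) (x I) ≫ overScalar (unitModule X) V (c I)) =
      Finset.univ.sum fun I => c I • x I := by
  have h : (Finset.univ.sum fun I => evalAt (M := unitModule X) (x I) ≫ overScalar (unitModule X) V (c I)) =
      (toBidual F (unitModule X)).app V (Finset.univ.sum fun I => c I • x I) := by
    rw [map_sum]
    refine Finset.sum_congr rfl fun I _ => ?_
    rw [toBidual_app_apply, evalAt_smul, smul_overHom_def]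
  rw [h, ← CategoryTheory.comp_apply, ← Scheme.Modules.Hom.comp_app, IsIso.hom_inv_id, Scheme.Modules.Hom.id_app]
  rfl

/-- `(E ≅ E^∨∨)⁻¹ (Σ_I ev_{x_I} ≫ m_I) = Σ_I m_I(1) · x_I` for endomorphisms `m_I` of `𝒪|_V`. [cite: Hartshorne1977, II Ex. 5.1 (a)] -/
theorem inv_toBidual_app_sum_evalAt_comp_endo (F : X.Modules) [IsIso (toBidual F (unitModule X))] (V : X.Opens)
    {N : ℕ} (x : Fin N → Γ(F, V)) (m : Fin N → ((unitModule X).over V ⟶ (unitModule X).over V)) :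
    (inv (toBidual F (unitModule X))).app V (Finset.univ.sum fun I => evalAt (M := unitModule X) (x I) ≫ m I) =
      Finset.univ.sum fun I =>
        HSMul.hSMul (α := Γ(X, V)) (β := Γ(F, V)) (appLE (m I) (𝟙 V) (1 : Γ(X, V))) (x I) := by
  rw [← inv_toBidual_app_sum_evalAt_comp_overScalar]
  congr 2
  exact funext fun I => by rw [← over_unit_endo_eq_overScalar]

end OverCalc

/-! ## §8 (W) the twisting terms correspond under `α`: `α_{j+1}(d(g♯a) ∧ φ) = da ∧ α_j(φ)` -/

section WedgeCompat

/-- **The wedge coefficients along the pulled-back frame are the pull-backs of the wedge coefficients**: with `ω_I` the frame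
of `Ωʲ_A`, `coord'_K` the frame coordinates of `Ωʲ⁺¹_A`, `θ = θ(g)` the `dg`-twists,
`coord'_K(θ_{j+1}((θ_j⁻¹ω_I) ∧ d(g♯a))) = g♯(coord'_K(ω_I ∧ da))` on `g⁻¹U` — because `θ_j⁻¹ω_I = g^♯ω_I`
(`formsTwist_inv_app_frameVec`), the wedge is multiplicative under `g^♯` (`wedge_evalAt_dSection_comap`) and
`coord'_K ∘ θ_{j+1} ∘ g^♯ = g♯ ∘ coord'_K` (`comap_comp_map_formsTwist_frameCoord`). CONDITIONAL on `hΩ`.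
[cite: Hartshorne1977, II Ex. 5.16 (e), II Prop. 8.11, III Prop. 10.4] [cite: MumfordAV1970, §4 (iii) (p. 42)] -/
theorem wedgeFrameCoeff_comap (hΩ : Mumford1970_cotangentSheaf_abelianVariety_free) (A : AbelianVariety ℂ)
    (g : A ⟶ A) (hg : IsIsogeny g) (j : ℕ) (U : A.X.left.Opens) (a : Γ(A.X.left, U))
    (I : Fin (A.dim.choose j)) (K : Fin (A.dim.choose (j + 1))) :
    appLE
        ((SheafOfModules.overFunctor _ (Hom.toSchemeHom g ⁻¹ᵁ U)).map
            (Limits.Pi.lift (fun K : Fin (A.dim.choose j) => if I = K then 𝟙 (unitModule A.X.left) else 0) ≫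
              (hodgeSheafFrame hΩ A j).inv ≫ (isogenyFormsTwist hΩ A g j).inv) ≫
          (SheafOfModules.overFunctor _ (Hom.toSchemeHom g ⁻¹ᵁ U)).map (wedgeSheafHom A.X j) ≫
            evalAt (M := hodgeSheaf A.X (j + 1)) (dSection A.X (Hom.toSchemeHom g ⁻¹ᵁ U) ((Hom.toSchemeHom g).app U a)) ≫
              (SheafOfModules.overFunctor _ (Hom.toSchemeHom g ⁻¹ᵁ U)).map
                ((isogenyFormsTwist hΩ A g (j + 1)).hom ≫ (hodgeSheafFrame hΩ A (j + 1)).hom ≫ Limits.Pi.π _ K))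
        (𝟙 _) (1 : Γ(A.X.left, Hom.toSchemeHom g ⁻¹ᵁ U)) =
      (Hom.toSchemeHom g).app U
        (appLE
          ((SheafOfModules.overFunctor _ U).map
              (Limits.Pi.lift (fun K : Fin (A.dim.choose j) => if I = K then 𝟙 (unitModule A.X.left) else 0) ≫
                (hodgeSheafFrame hΩ A j).inv) ≫
            (SheafOfModules.overFunctor _ U).map (wedgeSheafHom A.X j) ≫
              evalAt (M := hodgeSheaf A.X (j + 1)) (dSection A.X U a) ≫
                (SheafOfModules.overFunctor _ U).map ((hodgeSheafFrame hΩ A (j + 1)).hom ≫ Limits.Pi.π _ K))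
          (𝟙 U) (1 : Γ(A.X.left, U))) := by
  -- the wedge is multiplicative under `g^♯` (`wedge_evalAt_dSection_comap`), evaluated on the frame vector `ω_I|_U`
  have hrel := congrArg (fun m : (hodgeSheaf A.X j).over U ⟶
      ((pushforward (Hom.toSchemeHom g)).obj (hodgeSheaf A.X (j + 1))).over U =>
      appLE m (𝟙 U) (((Limits.Pi.lift (fun K : Fin (A.dim.choose j) => if I = K then 𝟙 (unitModule A.X.left) else 0) ≫
          (hodgeSheafFrame hΩ A j).inv)).app U (1 : Γ(A.X.left, U))))
    (wedge_evalAt_dSection_comap g.hom.hom.hom j U a)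
  simp only [appLE_comp, appLE_over_map, appLE_pushforwardOverHom, pushforward_map_app] at hrel
  -- the `θ⁻¹`-moved frame vector is the pulled-back frame vector (`formsTwist_inv_app_frameVec`)
  have hv : (Limits.Pi.lift (fun K : Fin (A.dim.choose j) => if I = K then 𝟙 (unitModule A.X.left) else 0) ≫
      (hodgeSheafFrame hΩ A j).inv ≫ (isogenyFormsTwist hΩ A g j).inv).app (Hom.toSchemeHom g ⁻¹ᵁ U)
        (1 : Γ(A.X.left, Hom.toSchemeHom g ⁻¹ᵁ U)) =
      (hodgeSheaf.comap g.hom.hom.hom j).app U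
        (((Limits.Pi.lift (fun K : Fin (A.dim.choose j) => if I = K then 𝟙 (unitModule A.X.left) else 0) ≫
          (hodgeSheafFrame hΩ A j).inv)).app U (1 : Γ(A.X.left, U))) :=
    formsTwist_inv_app_frameVec hΩ A j g hg I U
  -- values of the composites, then the frame coordinates of `θ ∘ g^♯` are `g♯ ∘ coord` (`comap_comp_map_formsTwist_frameCoord`)
  simp only [appLE_comp, appLE_over_map]
  rw [hv, appLE_congr_hom _ (𝟙 (Hom.toSchemeHom g ⁻¹ᵁ U)) ((Opens.map (Hom.toSchemeHom g).base).map (𝟙 U))]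
  erw [← hrel]
  change (hodgeSheaf.comap g.hom.hom.hom (j + 1) ≫ (pushforward (Hom.toSchemeHom g)).map
      ((isogenyFormsTwist hΩ A g (j + 1)).hom ≫ ((hodgeSheafFrame hΩ A (j + 1)).hom ≫ Limits.Pi.π _ K))).app U _ = _
  rw [comap_comp_map_formsTwist_frameCoord hΩ A g (j + 1) hg K, Scheme.Modules.Hom.comp_app, CategoryTheory.comp_apply,
    unitPushforwardHom_app_apply]

/-- **(W) for `α = isogenyTwistHodgePushforwardIso`: the twisting terms correspond**, `α_{j+1}(D(g♯a, φ)) = D(a, α_j φ)` for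
`a ∈ Γ(A, U)`, `φ ∈ Γ(g⁻¹U, 𝓗om(E^∨, Ωʲ))` (`D = wedgeD`, `D(a, φ) = φ` then `∧ da`). Proof: test after the injective
`(𝓗om((g_*E)^∨, Ωʲ⁺¹) ≅ ∏ g_*E) ∘ π_K`; decompose `φ = Σ_I ev_{t_I} ≫ (θ_j⁻¹ω_I)` along the `θ⁻¹`-moved frame and
`α_j φ = Σ_I ev_{t_I} ≫ ω_I` along the frame (same `t_I ∈ Γ(g⁻¹U, E)` by `isogenyTwistHodgePushforwardIso_hom_comp_twistFreeIso_π`);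
both `K`-components are then `Σ_I c_I · t_I` with the coefficients of `wedgeFrameCoeff_comap`. This is the hypothesis (W) of
the cell's `TwistPushforwardCompat` for THIS `α`. CONDITIONAL on `hΩ`.
[cite: BuchweitzFlenner2003, §3 (twisted jet sequences; reading: functoriality in the scheme)] [cite: Hartshorne1977, II Ex. 5.1, II Ex. 5.16 (e), III Prop. 10.4] -/
theorem isogenyTwistHodgePushforwardIso_hom_app_wedgeD (hΩ : Mumford1970_cotangentSheaf_abelianVariety_free) (A : AbelianVariety ℂ)
    (g : A ⟶ A) (hg : IsIsogeny g) (E : A.X.left.Modules)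
    (hE : IsFiniteLocallyFree E) (j : ℕ)
    (U : A.X.left.Opens) (a : Γ(A.X.left, U))
    (φ : (dual E).over (Hom.toSchemeHom g ⁻¹ᵁ U) ⟶ (hodgeSheaf A.X j).over (Hom.toSchemeHom g ⁻¹ᵁ U)) :
    (isogenyTwistHodgePushforwardIso hΩ A g hg (j + 1) E hE).hom.app U
        (wedgeD E j (Hom.toSchemeHom g ⁻¹ᵁ U) ((Hom.toSchemeHom g).app U a) φ) =
      wedgeD ((pushforward (Hom.toSchemeHom g)).obj E) j U a
        ((isogenyTwistHodgePushforwardIso hΩ A g hg j E hE).hom.app U φ) := by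
  have hgE := isogenyPushforwardFiniteLocallyFree_holds ℂ A A g hg E hE
  haveI := isIso_toBidual E hE
  haveI := isIso_toBidual ((pushforward (Hom.toSchemeHom g)).obj E) hgE
  -- Step 1: test after the injective frame isomorphism of `𝓗om((g_*E)^∨, Ωʲ⁺¹)`, componentwise
  apply ((ConcreteCategory.bijective_of_isIso ((twistFreeIso (hodgeSheafFrame hΩ A (j + 1))
    ((pushforward (Hom.toSchemeHom g)).obj E) hgE).hom.app U)).1)
  refine pi_sections_ext _ U _ _ fun K => ?_
  change ((isogenyTwistHodgePushforwardIso hΩ A g hg (j + 1) E hE).hom ≫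
      (twistFreeIso (hodgeSheafFrame hΩ A (j + 1)) ((pushforward (Hom.toSchemeHom g)).obj E) hgE).hom ≫
        Limits.Pi.π _ K).app U (wedgeD E j (Hom.toSchemeHom g ⁻¹ᵁ U) ((Hom.toSchemeHom g).app U a) φ) =
    ((twistFreeIso (hodgeSheafFrame hΩ A (j + 1)) ((pushforward (Hom.toSchemeHom g)).obj E) hgE).hom ≫
        Limits.Pi.π _ K).app U (wedgeD ((pushforward (Hom.toSchemeHom g)).obj E) j U a
          ((isogenyTwistHodgePushforwardIso hΩ A g hg j E hE).hom.app U φ))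
  rw [isogenyTwistHodgePushforwardIso_hom_comp_twistFreeIso_π hΩ A g hg (j + 1) E hE K, twistFreeIso_hom_π]
  change (inv (toBidual E (unitModule A.X.left))).app (Hom.toSchemeHom g ⁻¹ᵁ U)
      (wedgeD E j (Hom.toSchemeHom g ⁻¹ᵁ U) ((Hom.toSchemeHom g).app U a) φ ≫
        (SheafOfModules.overFunctor _ (Hom.toSchemeHom g ⁻¹ᵁ U)).map
          ((isogenyFormsTwist hΩ A g (j + 1)).hom ≫ (hodgeSheafFrame hΩ A (j + 1)).hom ≫ Limits.Pi.π _ K)) =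
    (inv (toBidual ((pushforward (Hom.toSchemeHom g)).obj E) (unitModule A.X.left))).app U
      (wedgeD ((pushforward (Hom.toSchemeHom g)).obj E) j U a ((isogenyTwistHodgePushforwardIso hΩ A g hg j E hE).hom.app U φ) ≫
        (SheafOfModules.overFunctor _ U).map ((hodgeSheafFrame hΩ A (j + 1)).hom ≫ Limits.Pi.π _ K))
  -- Step 2: the frame components `t_I` of `α_j φ` are those of `φ` along the `θ⁻¹`-moved frame
  have ht : ∀ I : Fin (A.dim.choose j),
      (inv (toBidual ((pushforward (Hom.toSchemeHom g)).obj E) (unitModule A.X.left))).app U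
        ((isogenyTwistHodgePushforwardIso hΩ A g hg j E hE).hom.app U φ ≫ (SheafOfModules.overFunctor _ U).map
          ((hodgeSheafFrame hΩ A j).hom ≫ Limits.Pi.π _ I)) =
      (inv (toBidual E (unitModule A.X.left))).app (Hom.toSchemeHom g ⁻¹ᵁ U)
        (φ ≫ (SheafOfModules.overFunctor _ (Hom.toSchemeHom g ⁻¹ᵁ U)).map
          ((isogenyFormsTwist hΩ A g j).hom ≫ (hodgeSheafFrame hΩ A j).hom ≫ Limits.Pi.π _ I)) := by
    intro I
    have h1 : ((isogenyTwistHodgePushforwardIso hΩ A g hg j E hE).hom ≫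
        (twistFreeIso (hodgeSheafFrame hΩ A j) ((pushforward (Hom.toSchemeHom g)).obj E) hgE).hom ≫
          Limits.Pi.π _ I).app U φ =
        ((pushforward (Hom.toSchemeHom g)).map (sheafHomMap (dual E) ((isogenyFormsTwist hΩ A g j).hom ≫
          ((hodgeSheafFrame hΩ A j).hom ≫ Limits.Pi.π _ I)) ≫ inv (toBidual E (unitModule _)))).app U φ := by
      rw [isogenyTwistHodgePushforwardIso_hom_comp_twistFreeIso_π hΩ A g hg j E hE I]
    have h2 : ((twistFreeIso (hodgeSheafFrame hΩ A j) ((pushforward (Hom.toSchemeHom g)).obj E) hgE).hom ≫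
          Limits.Pi.π _ I).app U ((isogenyTwistHodgePushforwardIso hΩ A g hg j E hE).hom.app U φ) =
        (sheafHomMap (dual ((pushforward (Hom.toSchemeHom g)).obj E)) ((hodgeSheafFrame hΩ A j).hom ≫ Limits.Pi.π _ I) ≫
          inv (toBidual ((pushforward (Hom.toSchemeHom g)).obj E) (unitModule _))).app U
          ((isogenyTwistHodgePushforwardIso hΩ A g hg j E hE).hom.app U φ) := by
      rw [twistFreeIso_hom_π]
    simp only [Scheme.Modules.Hom.comp_app, CategoryTheory.comp_apply, pushforward_map_app, sheafHomMap_app_apply] at h1 h2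
    exact h2.symm.trans h1
  -- Step 3: decompose `φ` and `α_j φ` along the frames and compute both sides as `Σ_I c_I · t_I`
  have hφ := hom_eq_sum_evalAt_comp E (hodgeSheaf A.X j)
    (fun I => (isogenyFormsTwist hΩ A g j).hom ≫ (hodgeSheafFrame hΩ A j).hom ≫ Limits.Pi.π _ I)
    (fun I => Limits.Pi.lift (fun K : Fin (A.dim.choose j) => if I = K then 𝟙 (unitModule A.X.left) else 0) ≫
      (hodgeSheafFrame hΩ A j).inv ≫ (isogenyFormsTwist hΩ A g j).inv)
    (sum_coord_comp_frameVec_conj (hodgeSheafFrame hΩ A j) (isogenyFormsTwist hΩ A g j)) (Hom.toSchemeHom g ⁻¹ᵁ U) φ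
  have hψ := hom_eq_sum_evalAt_comp ((pushforward (Hom.toSchemeHom g)).obj E) (hodgeSheaf A.X j)
    (fun I => (hodgeSheafFrame hΩ A j).hom ≫ Limits.Pi.π _ I)
    (fun I => (Limits.Pi.lift (fun K : Fin (A.dim.choose j) => if I = K then 𝟙 (unitModule A.X.left) else 0) ≫
      (hodgeSheafFrame hΩ A j).inv))
    (sum_coord_comp_frameVec (hodgeSheafFrame hΩ A j)) U ((isogenyTwistHodgePushforwardIso hΩ A g hg j E hE).hom.app U φ)
  beta_reduce at hφ hψ
  rw [wedgeD, wedgeD]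
  conv_lhs => rw [hφ]
  conv_rhs => rw [hψ]
  simp only [Preadditive.sum_comp, Category.assoc]
  rw [inv_toBidual_app_sum_evalAt_comp_endo, inv_toBidual_app_sum_evalAt_comp_endo]
  refine Finset.sum_congr rfl fun I _ => ?_
  rw [ht I, wedgeFrameCoeff_comap hΩ A g hg j U a I K]
  rfl

end WedgeCompat

end Summit.HodgeConjecture.HodgeConjecture.Ring2.SemiregularRepresentatives

end
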